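import Summits.QuantumFields.YangMills.Theorems.SmallCircleAnchorAnchorGapGaussianCovSmooth
import Literature.Probability.LatticeModels.BattleFederbushExpansion
import HarnessLib

/-!
# Crux `AnchorGap` (stmt-QuantumFields-11141), line `registered` — LOCALITY of GREP's line operators:
# `Dop ℓ` preserves "sees only the atoms of `Y`", passes through factors that do not see the atoms of
# `ℓ`, and the product of the atom factors splits accordingly (step (G5) of the assembly of GREP,
# part: the locality hypotheses `hF`/`hG` of the factorisation (G3) at the decoupled point)

GREP (`stub_gaussianBBFPolymerRep`, `Cruxes/AnchorGap/Lines/birth.lean`) factorises, at the decoupled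
point of a script `s` with point set `Y ⊆ X`, the interpolated expectation of
`s.lines.foldl (H ℓ ↦ Dop ℓ H) (Π_{b∈X} G_b)` by ✓FACT (`stub_gaussianCovBlockFactor`, in px19 g17's
(G3) form `gaussExpect_decPt_mul_eq … F G hF hG`), which wants the observable written as `F·G` with
`F` seeing only the atoms of `Y` and `G` seeing only the atoms outside `Y`.  This file supplies that
rewriting from GREP's hypotheses (each `G_b` is `C^∞` and ATOM-LOCAL:
`(∀ i, blk i = b → φ i = ψ i) → G_b φ = G_b ψ`):

* §1 a differentiable function of the coordinates `{i | p i}` only has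
  `DH(φ)v = DH(πφ)(πv)` for the coordinate projection `π` (`fderiv_apply_eq_of_seesOnly`, chain rule
  through the continuous linear map `π`), hence its directional derivatives see only those
  coordinates (`seesOnly_fderiv_apply`) and vanish in directions supported off them
  (`fderiv_apply_eq_zero_of_seesOnly`); all iterated derivatives see only those coordinates
  (`seesOnly_iteratedFDeriv`, `ContinuousLinearMap.iteratedFDeriv_comp_right`);
* §2 `Dop ℓ H` and `L.foldl (H ℓ ↦ Dop ℓ H) H` see only the atoms of `Y` when `H` does
  (`seesOnly_dop`, `seesOnly_foldl_dop`); `Π_{b∈Z} G_b` sees only the atoms of `Z`, `Π_{b∈X∖Y} G_b`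
  only the atoms outside `Y` (`prod_seesOnly`, `prod_sdiff_seesOnly_compl`);
* §3 Leibniz with an inert factor: for a line `ℓ` between atoms of `Y` and `G'` not seeing the atoms
  of `Y`, `∂_x∂_y (F·G') = (∂_x∂_y F)·G'` on the pairs of `ℓ` (`iteratedFDeriv_two_mul_of_inert`),
  `Dop ℓ (F·G') = (Dop ℓ F)·G'` (`dop_mul_of_inert`) and
  `L.foldl Dop (F·G') = (L.foldl Dop F)·G'` (`foldl_dop_mul_of_inert`);
* §4 in GREP's tokens, for a script `s` with `Finset.univ.image s.y = Y`, `Y ⊆ X`: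
  `s.lines.foldl Dop (Π_{b∈X} G_b) = (s.lines.foldl Dop (Π_{b∈Y} G_b)) · Π_{b∈X∖Y} G_b`
  (`foldl_dop_prod_eq_mul`), the first factor seeing only the atoms of `Y`
  (`seesOnly_foldl_dop_prod`), the second only the atoms outside `Y` — the `hF`/`hG` of (G3).

The smoothness of `Dop ℓ F` for smooth `F` enters §2–§4 as the HYPOTHESIS `hD` (discharged by px19
g17's (G2c) `LineDop.dop_contDiff blk C` BY NAME; not restated here).  [folklore] finite-dimensional
calculus; no definition, no named fact; GREP's `Dop` `let`-text is INLINED token for token.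
-/

set_option autoImplicit false

namespace Summit.QuantumFields.YangMills.Theorems.AnchorGap.DopLocal

open Finset
open scoped ContDiff

variable {ι : Type} [Fintype ι]

/-! ### §1 Functions that see only a set of coordinates: derivatives -/

/-- **A function of some coordinates only has derivatives depending on those coordinates only, and
no derivative in the other directions.**  If `H φ` depends only on the coordinates `i` with `p i`
(`H φ = H ψ` whenever `φ, ψ` agree there) and `H` is differentiable, then
`DH(φ) v = DH(π φ)(π v)` for the coordinate projection `π` onto `{i | p i}`. [folklore] -/
theorem fderiv_apply_eq_of_seesOnly (p : ι → Prop) [DecidablePred p] {H : (ι → ℝ) → ℝ}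
    (hH : Differentiable ℝ H)
    (hsees : ∀ φ ψ : ι → ℝ, (∀ i, p i → φ i = ψ i) → H φ = H ψ) (φ v : ι → ℝ) :
    fderiv ℝ H φ v = fderiv ℝ H (fun i => if p i then φ i else 0) (fun i => if p i then v i else 0) := by
  -- the coordinate projection as a continuous linear map
  let π : (ι → ℝ) →L[ℝ] (ι → ℝ) :=
    ContinuousLinearMap.pi fun i => if p i then ContinuousLinearMap.proj i else 0
  have hπ : ∀ φ : ι → ℝ, π φ = fun i => if p i then φ i else 0 := by
    intro φ; funext i
    simp only [π, ContinuousLinearMap.pi_apply]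
    split_ifs <;> simp
  have hcomp : H = H ∘ π := by
    funext φ
    refine hsees φ (π φ) fun i hi => ?_
    rw [hπ]; simp [hi]
  have hd : fderiv ℝ H φ = (fderiv ℝ H (π φ)).comp π := by
    conv_lhs => rw [hcomp]
    rw [fderiv_comp φ (hH (π φ)) π.differentiableAt, π.fderiv]
  rw [hd, ContinuousLinearMap.comp_apply, hπ, hπ]

/-- A directional derivative of a function of some coordinates only is again a function of those
coordinates only. [folklore] -/
theorem seesOnly_fderiv_apply (p : ι → Prop) [DecidablePred p] {H : (ι → ℝ) → ℝ}
    (hH : Differentiable ℝ H)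
    (hsees : ∀ φ ψ : ι → ℝ, (∀ i, p i → φ i = ψ i) → H φ = H ψ) (v : ι → ℝ) :
    ∀ φ ψ : ι → ℝ, (∀ i, p i → φ i = ψ i) →
      fderiv ℝ H φ v = fderiv ℝ H ψ v := by
  intro φ ψ h
  rw [fderiv_apply_eq_of_seesOnly p hH hsees φ v, fderiv_apply_eq_of_seesOnly p hH hsees ψ v]
  have : (fun i => if p i then φ i else 0) = fun i => if p i then ψ i else 0 := by
    funext i; split_ifs with hi
    · exact h i hi
    · rfl
  rw [this]

/-- A function of some coordinates only has zero derivative in every direction vanishing on those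
coordinates. [folklore] -/
theorem fderiv_apply_eq_zero_of_seesOnly (p : ι → Prop) [DecidablePred p] {H : (ι → ℝ) → ℝ}
    (hH : Differentiable ℝ H)
    (hsees : ∀ φ ψ : ι → ℝ, (∀ i, p i → φ i = ψ i) → H φ = H ψ) (φ v : ι → ℝ)
    (hv : ∀ i, p i → v i = 0) : fderiv ℝ H φ v = 0 := by
  rw [fderiv_apply_eq_of_seesOnly p hH hsees φ v]
  have : (fun i => if p i then v i else 0) = 0 := by
    funext i; split_ifs with hi
    · exact hv i hi
    · rfl
  rw [this, map_zero]

/-- **All iterated derivatives of a smooth function of some coordinates only see those coordinates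
only** (as multilinear maps): `DⁿH(φ) = DⁿH(ψ)` when `φ, ψ` agree on `{i | p i}` — chain rule
through the coordinate projection (`ContinuousLinearMap.iteratedFDeriv_comp_right`). [folklore] -/
theorem seesOnly_iteratedFDeriv (p : ι → Prop) [DecidablePred p] {H : (ι → ℝ) → ℝ}
    (hH : ContDiff ℝ (⊤ : ℕ∞) H)
    (hsees : ∀ φ ψ : ι → ℝ, (∀ i, p i → φ i = ψ i) → H φ = H ψ) (n : ℕ) :
    ∀ φ ψ : ι → ℝ, (∀ i, p i → φ i = ψ i) → iteratedFDeriv ℝ n H φ = iteratedFDeriv ℝ n H ψ := by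
  let π : (ι → ℝ) →L[ℝ] (ι → ℝ) :=
    ContinuousLinearMap.pi fun i => if p i then ContinuousLinearMap.proj i else 0
  have hπ : ∀ φ : ι → ℝ, π φ = fun i => if p i then φ i else 0 := by
    intro φ; funext i
    simp only [π, ContinuousLinearMap.pi_apply]
    split_ifs <;> simp
  have hcomp : H = H ∘ π := by
    funext φ
    refine hsees φ (π φ) fun i hi => ?_
    rw [hπ]; simp [hi]
  intro φ ψ h
  have hπeq : π φ = π ψ := by
    rw [hπ, hπ]; funext i; split_ifs with hi
    · exact h i hi
    · rfl
  rw [hcomp, π.iteratedFDeriv_comp_right hH φ (by exact_mod_cast le_top),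
    π.iteratedFDeriv_comp_right hH ψ (by exact_mod_cast le_top), hπeq]

variable [DecidableEq ι] {β : Type} [DecidableEq β]

/-! ### §2 Locality is preserved by the line operators; products of atom-local factors -/

/-- **GREP's line operator preserves locality**: if `H` sees only the atoms of `Y`, so does
`Dop ℓ H` (any line `ℓ`). [folklore] -/
theorem seesOnly_dop (blk : ι → β) (C : Matrix ι ι ℝ) (ℓ : Sym2 β) (Y : Finset β)
    {H : (ι → ℝ) → ℝ} (hH : ContDiff ℝ (⊤ : ℕ∞) H)
    (hsees : ∀ φ ψ : ι → ℝ, (∀ i, blk i ∈ Y → φ i = ψ i) → H φ = H ψ) :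
    ∀ φ ψ : ι → ℝ, (∀ i, blk i ∈ Y → φ i = ψ i) →
      ((1 / 2 : ℝ) * ∑ x : ι, ∑ y : ι, if s(blk x, blk y) = ℓ ∧ blk x ≠ blk y
        then C x y * iteratedFDeriv ℝ 2 H φ ![Pi.single x 1, Pi.single y 1] else 0)
      = ((1 / 2 : ℝ) * ∑ x : ι, ∑ y : ι, if s(blk x, blk y) = ℓ ∧ blk x ≠ blk y
        then C x y * iteratedFDeriv ℝ 2 H ψ ![Pi.single x 1, Pi.single y 1] else 0) := by
  classical
  intro φ ψ h
  rw [seesOnly_iteratedFDeriv (fun i => blk i ∈ Y) hH hsees 2 φ ψ h]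

/-- **The iterated line operators of a script preserve locality** (`List.foldl`; the smoothness of
each `Dop ℓ F` — px19 g17's (G2c) `LineDop.dop_contDiff` — enters as the hypothesis `hD`).
[folklore] -/
theorem seesOnly_foldl_dop (blk : ι → β) (C : Matrix ι ι ℝ)
    (hD : ∀ (ℓ : Sym2 β) (F : (ι → ℝ) → ℝ), ContDiff ℝ (⊤ : ℕ∞) F →
      ContDiff ℝ (⊤ : ℕ∞) (fun φ : ι → ℝ => (1 / 2 : ℝ) * ∑ x : ι, ∑ y : ι,
        if s(blk x, blk y) = ℓ ∧ blk x ≠ blk y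
          then C x y * iteratedFDeriv ℝ 2 F φ ![Pi.single x 1, Pi.single y 1] else 0))
    (Y : Finset β) (L : List (Sym2 β))
    {H : (ι → ℝ) → ℝ} (hH : ContDiff ℝ (⊤ : ℕ∞) H)
    (hsees : ∀ φ ψ : ι → ℝ, (∀ i, blk i ∈ Y → φ i = ψ i) → H φ = H ψ) :
    ∀ φ ψ : ι → ℝ, (∀ i, blk i ∈ Y → φ i = ψ i) →
      L.foldl (fun (H : (ι → ℝ) → ℝ) (ℓ : Sym2 β) => fun φ : ι → ℝ =>
          (1 / 2 : ℝ) * ∑ x : ι, ∑ y : ι, if s(blk x, blk y) = ℓ ∧ blk x ≠ blk y then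
            C x y * iteratedFDeriv ℝ 2 H φ ![Pi.single x 1, Pi.single y 1] else 0) H φ
        = L.foldl (fun (H : (ι → ℝ) → ℝ) (ℓ : Sym2 β) => fun φ : ι → ℝ =>
          (1 / 2 : ℝ) * ∑ x : ι, ∑ y : ι, if s(blk x, blk y) = ℓ ∧ blk x ≠ blk y then
            C x y * iteratedFDeriv ℝ 2 H φ ![Pi.single x 1, Pi.single y 1] else 0) H ψ := by
  induction L generalizing H with
  | nil => exact hsees
  | cons ℓ L ih =>
    simp only [List.foldl_cons]
    exact ih (hD ℓ H hH) (seesOnly_dop blk C ℓ Y hH hsees)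

omit [Fintype ι] [DecidableEq ι] [DecidableEq β] in
/-- **A product of atom-local factors over `Z` sees only the atoms of `Z`** (GREP's atom-locality
hypothesis on the `G_b`, verbatim). [folklore] -/
theorem prod_seesOnly (blk : ι → β) {G : β → (ι → ℝ) → ℝ}
    (hGl : ∀ (b : β) (φ ψ : ι → ℝ), (∀ i : ι, blk i = b → φ i = ψ i) → G b φ = G b ψ)
    (Z : Finset β) :
    ∀ φ ψ : ι → ℝ, (∀ i, blk i ∈ Z → φ i = ψ i) → ∏ b ∈ Z, G b φ = ∏ b ∈ Z, G b ψ :=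
  fun φ ψ h => Finset.prod_congr rfl fun b hb => hGl b φ ψ fun i hi => h i (hi ▸ hb)

omit [Fintype ι] [DecidableEq ι] in
/-- The complementary product `Π_{b∈X∖Y} G_b` sees only the atoms OUTSIDE `Y`. [folklore] -/
theorem prod_sdiff_seesOnly_compl (blk : ι → β) {G : β → (ι → ℝ) → ℝ}
    (hGl : ∀ (b : β) (φ ψ : ι → ℝ), (∀ i : ι, blk i = b → φ i = ψ i) → G b φ = G b ψ)
    (X Y : Finset β) :
    ∀ φ ψ : ι → ℝ, (∀ i, blk i ∉ Y → φ i = ψ i) →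
      ∏ b ∈ X \ Y, G b φ = ∏ b ∈ X \ Y, G b ψ :=
  fun φ ψ h => Finset.prod_congr rfl fun b hb =>
    hGl b φ ψ fun i hi => h i (hi ▸ (Finset.mem_sdiff.1 hb).2)

/-! ### §3 Leibniz with an inert factor: `Dop ℓ (F·G') = (Dop ℓ F)·G'` -/

omit [DecidableEq ι] [DecidableEq β] in
/-- A directional derivative of `F·G'` in a direction that `G'` does not see is `(∂_v F)·G'`.
[folklore] -/
theorem fderiv_mul_apply_of_inert (p : ι → Prop) [DecidablePred p] {F G' : (ι → ℝ) → ℝ}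
    (hF : Differentiable ℝ F) (hG' : Differentiable ℝ G')
    (hG's : ∀ φ ψ : ι → ℝ, (∀ i, p i → φ i = ψ i) → G' φ = G' ψ)
    (v : ι → ℝ) (hv : ∀ i, p i → v i = 0) (φ : ι → ℝ) :
    fderiv ℝ (fun φ => F φ * G' φ) φ v = fderiv ℝ F φ v * G' φ := by
  have h0 := fderiv_apply_eq_zero_of_seesOnly p hG' hG's φ v hv
  have h1 : fderiv ℝ (fun φ => F φ * G' φ) φ = F φ • fderiv ℝ G' φ + G' φ • fderiv ℝ F φ :=
    fderiv_fun_mul (hF φ) (hG' φ)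
  have h2 : fderiv ℝ (fun φ => F φ * G' φ) φ v
      = F φ * fderiv ℝ G' φ v + G' φ * fderiv ℝ F φ v := by
    rw [h1]; rfl
  rw [h2, h0]
  ring

omit [DecidableEq β] in
/-- **The second partial `∂_x∂_y` of `F·G'` is `(∂_x∂_y F)·G'` when `G'` sees neither coordinate.**
[folklore] -/
theorem iteratedFDeriv_two_mul_of_inert (p : ι → Prop) [DecidablePred p] {F G' : (ι → ℝ) → ℝ}
    (hF : ContDiff ℝ (⊤ : ℕ∞) F) (hG' : ContDiff ℝ (⊤ : ℕ∞) G')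
    (hG's : ∀ φ ψ : ι → ℝ, (∀ i, p i → φ i = ψ i) → G' φ = G' ψ)
    (x y : ι) (hx : ¬ p x) (hy : ¬ p y) (φ : ι → ℝ) :
    iteratedFDeriv ℝ 2 (fun φ => F φ * G' φ) φ ![Pi.single x 1, Pi.single y 1]
      = iteratedFDeriv ℝ 2 F φ ![Pi.single x 1, Pi.single y 1] * G' φ := by
  -- `D²K(φ)[u, v] = ∂_u (φ ↦ DK(φ)v)(φ)` for smooth `K`
  have h2 : ∀ (K : (ι → ℝ) → ℝ), ContDiff ℝ (⊤ : ℕ∞) K → ∀ (u v θ : ι → ℝ),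
      iteratedFDeriv ℝ 2 K θ ![u, v] = fderiv ℝ (fun φ => fderiv ℝ K φ v) θ u := by
    intro K hK u v θ
    have hd : Differentiable ℝ (fderiv ℝ K) :=
      (contDiff_infty_iff_fderiv.1 hK).2.differentiable (by simp)
    rw [iteratedFDeriv_two_apply, fderiv_clm_apply (hd θ) (differentiableAt_const v)]
    simp
  have hFd : Differentiable ℝ F := hF.differentiable (by simp)
  have hG'd : Differentiable ℝ G' := hG'.differentiable (by simp)
  have hF1 : Differentiable ℝ (fun φ => fderiv ℝ F φ (Pi.single y 1)) :=
    ((contDiff_infty_iff_fderiv.1 hF).2.differentiable (by simp)).clm_apply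
      (differentiable_const _)
  have hvy : ∀ i, p i → (Pi.single y (1 : ℝ) : ι → ℝ) i = 0 :=
    fun i hi => Pi.single_eq_of_ne (show i ≠ y from fun h => hy (by rw [← h]; exact hi)) _
  have hvx : ∀ i, p i → (Pi.single x (1 : ℝ) : ι → ℝ) i = 0 :=
    fun i hi => Pi.single_eq_of_ne (show i ≠ x from fun h => hx (by rw [← h]; exact hi)) _
  have h1 : (fun φ => fderiv ℝ (fun φ => F φ * G' φ) φ (Pi.single y 1))
      = fun φ => fderiv ℝ F φ (Pi.single y 1) * G' φ :=
    funext fun φ => fderiv_mul_apply_of_inert p hFd hG'd hG's _ hvy φ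
  rw [h2 _ (hF.mul hG'), h2 _ hF, h1]
  exact fderiv_mul_apply_of_inert p hF1 hG'd hG's _ hvx φ

/-- **`Dop ℓ (F·G') = (Dop ℓ F)·G'`** for a line `ℓ` between atoms of `Y` and a factor `G'` that does
not see the atoms of `Y`. [folklore] -/
theorem dop_mul_of_inert (blk : ι → β) (C : Matrix ι ι ℝ) (Y : Finset β) (ℓ : Sym2 β)
    (hℓ : ∀ a ∈ ℓ, a ∈ Y) {F G' : (ι → ℝ) → ℝ}
    (hF : ContDiff ℝ (⊤ : ℕ∞) F) (hG' : ContDiff ℝ (⊤ : ℕ∞) G')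
    (hG's : ∀ φ ψ : ι → ℝ, (∀ i, blk i ∉ Y → φ i = ψ i) → G' φ = G' ψ) (φ : ι → ℝ) :
    ((1 / 2 : ℝ) * ∑ x : ι, ∑ y : ι, if s(blk x, blk y) = ℓ ∧ blk x ≠ blk y
        then C x y * iteratedFDeriv ℝ 2 (fun φ => F φ * G' φ) φ ![Pi.single x 1, Pi.single y 1]
        else 0)
      = ((1 / 2 : ℝ) * ∑ x : ι, ∑ y : ι, if s(blk x, blk y) = ℓ ∧ blk x ≠ blk y
        then C x y * iteratedFDeriv ℝ 2 F φ ![Pi.single x 1, Pi.single y 1] else 0) * G' φ := by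
  classical
  rw [mul_assoc, Finset.sum_mul]
  congr 1
  refine Finset.sum_congr rfl fun x _ => ?_
  rw [Finset.sum_mul]
  refine Finset.sum_congr rfl fun y _ => ?_
  by_cases hc : s(blk x, blk y) = ℓ ∧ blk x ≠ blk y
  · rw [if_pos hc, if_pos hc]
    have hxY : blk x ∈ Y := hℓ _ (hc.1 ▸ Sym2.mem_mk_left _ _)
    have hyY : blk y ∈ Y := hℓ _ (hc.1 ▸ Sym2.mem_mk_right _ _)
    rw [iteratedFDeriv_two_mul_of_inert (fun i => blk i ∉ Y) hF hG' hG's x y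
      (fun h => h hxY) (fun h => h hyY) φ]
    ring
  · rw [if_neg hc, if_neg hc, zero_mul]

/-- **The iterated line operators of a script act on the `Y`-factor only**:
`L.foldl Dop (F·G') = (L.foldl Dop F)·G'` for lines between atoms of `Y` and `G'` not seeing the
atoms of `Y` (`hD` = smoothness of `Dop ℓ F`, px19 g17's `LineDop.dop_contDiff`). [folklore] -/
theorem foldl_dop_mul_of_inert (blk : ι → β) (C : Matrix ι ι ℝ)
    (hD : ∀ (ℓ : Sym2 β) (F : (ι → ℝ) → ℝ), ContDiff ℝ (⊤ : ℕ∞) F →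
      ContDiff ℝ (⊤ : ℕ∞) (fun φ : ι → ℝ => (1 / 2 : ℝ) * ∑ x : ι, ∑ y : ι,
        if s(blk x, blk y) = ℓ ∧ blk x ≠ blk y
          then C x y * iteratedFDeriv ℝ 2 F φ ![Pi.single x 1, Pi.single y 1] else 0))
    (Y : Finset β) (L : List (Sym2 β)) (hL : ∀ ℓ ∈ L, ∀ a ∈ ℓ, a ∈ Y) {F G' : (ι → ℝ) → ℝ}
    (hF : ContDiff ℝ (⊤ : ℕ∞) F) (hG' : ContDiff ℝ (⊤ : ℕ∞) G')
    (hG's : ∀ φ ψ : ι → ℝ, (∀ i, blk i ∉ Y → φ i = ψ i) → G' φ = G' ψ) :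
    L.foldl (fun (H : (ι → ℝ) → ℝ) (ℓ : Sym2 β) => fun φ : ι → ℝ =>
        (1 / 2 : ℝ) * ∑ x : ι, ∑ y : ι, if s(blk x, blk y) = ℓ ∧ blk x ≠ blk y then
          C x y * iteratedFDeriv ℝ 2 H φ ![Pi.single x 1, Pi.single y 1] else 0)
        (fun φ => F φ * G' φ)
      = fun φ => L.foldl (fun (H : (ι → ℝ) → ℝ) (ℓ : Sym2 β) => fun φ : ι → ℝ =>
          (1 / 2 : ℝ) * ∑ x : ι, ∑ y : ι, if s(blk x, blk y) = ℓ ∧ blk x ≠ blk y then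
            C x y * iteratedFDeriv ℝ 2 H φ ![Pi.single x 1, Pi.single y 1] else 0) F φ * G' φ := by
  induction L generalizing F with
  | nil => rfl
  | cons ℓ L ih =>
    simp only [List.foldl_cons]
    have hstep : (fun φ : ι → ℝ => (1 / 2 : ℝ) * ∑ x : ι, ∑ y : ι,
        if s(blk x, blk y) = ℓ ∧ blk x ≠ blk y
          then C x y * iteratedFDeriv ℝ 2 (fun φ => F φ * G' φ) φ ![Pi.single x 1, Pi.single y 1]
          else 0)
        = fun φ => ((1 / 2 : ℝ) * ∑ x : ι, ∑ y : ι, if s(blk x, blk y) = ℓ ∧ blk x ≠ blk y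
          then C x y * iteratedFDeriv ℝ 2 F φ ![Pi.single x 1, Pi.single y 1] else 0) * G' φ :=
      funext fun φ => dop_mul_of_inert blk C Y ℓ (hL ℓ (by simp)) hF hG' hG's φ
    rw [hstep]
    exact ih (fun ℓ' hℓ' => hL ℓ' (List.mem_cons_of_mem _ hℓ')) (hD ℓ F hF)

/-! ### §4 In GREP's tokens: the split of `s.lines.foldl Dop (Π_{b∈X} G_b)` at a script with point
set `Y ⊆ X` -/

/-- **The product of GREP's atom factors splits under the iterated line operators of a script**: for
a script `s` whose points are the atoms of `Y ⊆ X`,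
`s.lines.foldl Dop (Π_{b∈X} G_b) = (s.lines.foldl Dop (Π_{b∈Y} G_b)) · Π_{b∈X∖Y} G_b`
(lines of a script join points of the script: lit ✓`BattleFederbush.Script.mem_image_of_mem_lines`).
[folklore] -/
theorem foldl_dop_prod_eq_mul (blk : ι → β) (C : Matrix ι ι ℝ)
    (hD : ∀ (ℓ : Sym2 β) (F : (ι → ℝ) → ℝ), ContDiff ℝ (⊤ : ℕ∞) F →
      ContDiff ℝ (⊤ : ℕ∞) (fun φ : ι → ℝ => (1 / 2 : ℝ) * ∑ x : ι, ∑ y : ι,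
        if s(blk x, blk y) = ℓ ∧ blk x ≠ blk y
          then C x y * iteratedFDeriv ℝ 2 F φ ![Pi.single x 1, Pi.single y 1] else 0))
    (G : β → (ι → ℝ) → ℝ) (hG : ∀ b : β, ContDiff ℝ (⊤ : ℕ∞) (G b))
    (hGl : ∀ (b : β) (φ ψ : ι → ℝ), (∀ i : ι, blk i = b → φ i = ψ i) → G b φ = G b ψ)
    (X Y : Finset β) (hYX : Y ⊆ X) {r : β} {k : ℕ}
    (s : Literature.Probability.LatticeModels.BattleFederbush.Script r k)
    (hs : Finset.univ.image s.y = Y) :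
    s.lines.foldl (fun (H : (ι → ℝ) → ℝ) (ℓ : Sym2 β) => fun φ : ι → ℝ =>
        (1 / 2 : ℝ) * ∑ x : ι, ∑ y : ι, if s(blk x, blk y) = ℓ ∧ blk x ≠ blk y then
          C x y * iteratedFDeriv ℝ 2 H φ ![Pi.single x 1, Pi.single y 1] else 0)
        (fun φ : ι → ℝ => ∏ b ∈ X, G b φ)
      = fun φ => s.lines.foldl (fun (H : (ι → ℝ) → ℝ) (ℓ : Sym2 β) => fun φ : ι → ℝ =>
          (1 / 2 : ℝ) * ∑ x : ι, ∑ y : ι, if s(blk x, blk y) = ℓ ∧ blk x ≠ blk y then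
            C x y * iteratedFDeriv ℝ 2 H φ ![Pi.single x 1, Pi.single y 1] else 0)
          (fun φ : ι → ℝ => ∏ b ∈ Y, G b φ) φ * ∏ b ∈ X \ Y, G b φ := by
  have hsplit : (fun φ : ι → ℝ => ∏ b ∈ X, G b φ)
      = fun φ => (∏ b ∈ Y, G b φ) * ∏ b ∈ X \ Y, G b φ := by
    funext φ; rw [mul_comm, Finset.prod_sdiff hYX]
  rw [hsplit]
  exact foldl_dop_mul_of_inert blk C hD Y s.lines
    (fun ℓ hℓ a ha => hs ▸
      Literature.Probability.LatticeModels.BattleFederbush.Script.mem_image_of_mem_lines s ℓ hℓ a ha)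
    (contDiff_prod fun b _ => hG b) (contDiff_prod fun b _ => hG b)
    (prod_sdiff_seesOnly_compl blk hGl X Y)

/-- **The `Y`-factor sees only the atoms of `Y`** — the `hF` of the (G3) factorisation
`gaussExpect_decPt_mul_eq` for `F := s.lines.foldl Dop (Π_{b∈Y} G_b)`; the `hG` for
`G := Π_{b∈X∖Y} G_b` is `prod_sdiff_seesOnly_compl`. [folklore] -/
theorem seesOnly_foldl_dop_prod (blk : ι → β) (C : Matrix ι ι ℝ)
    (hD : ∀ (ℓ : Sym2 β) (F : (ι → ℝ) → ℝ), ContDiff ℝ (⊤ : ℕ∞) F →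
      ContDiff ℝ (⊤ : ℕ∞) (fun φ : ι → ℝ => (1 / 2 : ℝ) * ∑ x : ι, ∑ y : ι,
        if s(blk x, blk y) = ℓ ∧ blk x ≠ blk y
          then C x y * iteratedFDeriv ℝ 2 F φ ![Pi.single x 1, Pi.single y 1] else 0))
    (G : β → (ι → ℝ) → ℝ) (hG : ∀ b : β, ContDiff ℝ (⊤ : ℕ∞) (G b))
    (hGl : ∀ (b : β) (φ ψ : ι → ℝ), (∀ i : ι, blk i = b → φ i = ψ i) → G b φ = G b ψ)
    (Y : Finset β) (L : List (Sym2 β)) :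
    ∀ φ ψ : ι → ℝ, (∀ i, blk i ∈ Y → φ i = ψ i) →
      L.foldl (fun (H : (ι → ℝ) → ℝ) (ℓ : Sym2 β) => fun φ : ι → ℝ =>
          (1 / 2 : ℝ) * ∑ x : ι, ∑ y : ι, if s(blk x, blk y) = ℓ ∧ blk x ≠ blk y then
            C x y * iteratedFDeriv ℝ 2 H φ ![Pi.single x 1, Pi.single y 1] else 0)
          (fun φ : ι → ℝ => ∏ b ∈ Y, G b φ) φ
        = L.foldl (fun (H : (ι → ℝ) → ℝ) (ℓ : Sym2 β) => fun φ : ι → ℝ =>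
          (1 / 2 : ℝ) * ∑ x : ι, ∑ y : ι, if s(blk x, blk y) = ℓ ∧ blk x ≠ blk y then
            C x y * iteratedFDeriv ℝ 2 H φ ![Pi.single x 1, Pi.single y 1] else 0)
          (fun φ : ι → ℝ => ∏ b ∈ Y, G b φ) ψ :=
  seesOnly_foldl_dop blk C hD Y L (contDiff_prod fun b _ => hG b) (prod_seesOnly blk hGl Y)

end Summit.QuantumFields.YangMills.Theorems.AnchorGap.DopLocal
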